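import Literature.AlgebraicGeometry.Motives.EllAdicCohomologyFinitenessProofs
import HarnessLib

/-!
# The long exact sequence of pro-étale cohomology attached to a short exact sequence of
# coefficient groups; Milne's sequences `0 → Hʳ(ℤ_ℓ)/ℓˢ → Hʳ(ℤ/ℓˢ) → Hʳ⁺¹(ℤ_ℓ)[ℓˢ] → 0`

Let `0 → A →(φ) B →(ψ) C → 0` be a short exact sequence of topological abelian groups in which
`φ` is a topological embedding and `ψ` admits a continuous set-theoretic section
(`IsContinuousShortExact φ ψ`; e.g. `0 → ℤ_ℓ →(ℓˢ) ℤ_ℓ → ℤ/ℓˢ → 0`, or any short exact sequence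
of discrete groups). Then for every scheme `X` the sequence of pro-étale sheaves
`0 → F_A → F_B → F_C → 0` (`F_A : U ↦ C(U, A)`, Bhatt–Scholze Lemma 4.2.12; lifted to `Ab.{u+1}`
as `proetSheaf`, `ProetCohomologyModule.lean`) is exact **already on sections over every
`U ∈ X_proét`**, hence short exact in `Sheaf(X_proét, Ab)` (`proetSheaf_shortExact`), and Mathlib's
covariant long exact sequence of `Ext`-groups (`Abelian.Ext.covariant_sequence_exact₁₂₃`) yields
the long exact cohomology sequence

`⋯ → Hⁱ(X_proét, F_A) → Hⁱ(X_proét, F_B) → Hⁱ(X_proét, F_C) →(δ) Hⁱ⁺¹(X_proét, F_A) → ⋯`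

(`ProetCohomology.δ`, `ProetCohomology.exact₁`, `exact₂`, `exact₃`, and the vanishing of
consecutive composites), for arbitrary such coefficient sequences.

For the Bockstein sequences `0 → ℤ_ℓ →(ℓˢ) ℤ_ℓ → ℤ/ℓˢ → 0`
(`isContinuousShortExact_powSMulHom`; the sheaf-level short exactness for these was first proved
in `EllAdicCohomologyFinitenessProofs.lean`, `powSMulShortComplex_shortExact`, whose maps are the
ones used here) this gives the **second half of Milne, *Étale cohomology*, V Lemma 1.11** for the
pro-étale groups `Hʳ(Y_proét, ℤ_ℓ)` with their canonical `ℤ_ℓ`-action: the exact sequences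
`0 → Hʳ(Y, ℤ_ℓ)^{(ℓˢ)} → Hʳ(Y, ℤ/ℓˢ) → Hʳ⁺¹(Y, ℤ_ℓ)_{ℓˢ} → 0`, i.e. exactness at `Hʳ(Y, ℤ/ℓˢ)`
(`ProetCohomology.bockstein_eq_zero_iff`) and at `Hʳ⁺¹(Y, ℤ_ℓ)`
(`ProetCohomology.pow_smul_eq_zero_iff`); exactness at `Hʳ(Y, ℤ_ℓ)` is
`ProetCohomology.exists_pow_smul_eq_of_map_reductionHom_eq_zero` (part III). Milne obtains these
sequences by passing to the inverse limit in the cohomology sequences of `0 → F_n → F_{n+s} → F_s → 0`;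
on the pro-étale site `F_{ℤ_ℓ} = 𝒪_{ℚ_ℓ,Y}` is itself a sheaf (Bhatt–Scholze Def. 6.8.1) and no
limit is needed.

## References

* J. S. Milne, *Étale cohomology*, Princeton (reissue 2025), V Lemma 1.11 (held copy p. 177:
  statement with the exact sequences; proof). [Milne2025]
* B. Bhatt, P. Scholze, *The pro-étale topology for schemes*, Astérisque 369 (2015),
  Lemma 4.2.12, Def. 6.8.1. [BhattScholze2015]

## Design notes

* `shortExact_of_sections`: a short complex of abelian sheaves on any site that is short exact
  on sections over every object is short exact — monos/epis are detected by the faithful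
  functor to presheaves and the kernel is built sectionwise (`KernelFork.IsLimit.ofι'`). (Part III
  proves the special case differently, through `JointlyReflectIsomorphisms.shortExact_iff` and
  the exactness of sheafification.)
* Hypotheses on `(φ, ψ)` are bundled in the structure `IsContinuousShortExact`.
* The connecting homomorphism is composition with Mathlib's `ShortComplex.ShortExact.extClass`.
* Mathlib searches: `Ext.covariant_sequence_exact₁/₂/₃`, `ShortExact.extClass`, `comp_extClass`,
  `extClass_comp`, `KernelFork.IsLimit.ofι'`, `ShortComplex.exact_of_f_is_kernel`,
  `Sheaf.Hom.mono_of_presheaf_mono`, `NatTrans.mono_of_mono_app`. Literature: part III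
  (`powSMulHom`, `reductionHom`, `ProetCohomology.smul_def` reused).
-/

universe w v' u' u

open CategoryTheory AlgebraicGeometry Limits

noncomputable section

namespace Literature.AlgebraicGeometry.Motives

/-! ### A sectionwise criterion for short exactness of abelian sheaves -/

section Sheaf

variable {C₀ : Type u'} [Category.{v'} C₀] {J : GrothendieckTopology C₀}
  [HasSheafify J AddCommGrpCat.{w}]

/-- **A short complex of abelian sheaves which is short exact on sections over every object is
short exact.** If `S = (F₁ →(f) F₂ →(g) F₃)` is a short complex in `Sheaf(J, Ab)` such that for
every `U` the map `f_U` is injective, `g_U` is surjective and `ker g_U ⊆ im f_U`, then `S` is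
short exact: `f` is a monomorphism and `g` an epimorphism because the forgetful functor to
presheaves is faithful, and `f` is a kernel of `g` because kernels of sheaves are computed
sectionwise (the lift of a morphism killed by `g` is built sectionwise through the injections
`f_U`). (Sheaf epimorphisms need not be surjective on sections; the criterion is sufficient, not
necessary.) [folklore] -/
theorem shortExact_of_sections (S : ShortComplex (Sheaf J AddCommGrpCat.{w}))
    (hf : ∀ U, Function.Injective (S.f.hom.app U))
    (hfg : ∀ (U) (y : S.X₂.obj.obj U), S.g.hom.app U y = 0 → ∃ x, S.f.hom.app U x = y)
    (hg : ∀ U, Function.Surjective (S.g.hom.app U)) : S.ShortExact := by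
  haveI : Mono S.f := by
    haveI : ∀ U, Mono (S.f.hom.app U) := fun U =>
      (AddCommGrpCat.mono_iff_injective _).2 (hf U)
    haveI : Mono S.f.hom := NatTrans.mono_of_mono_app _
    exact Sheaf.Hom.mono_of_presheaf_mono J AddCommGrpCat.{w} S.f
  haveI : Epi S.g := by
    haveI : ∀ U, Epi (S.g.hom.app U) := fun U =>
      (AddCommGrpCat.epi_iff_surjective _).2 (hg U)
    haveI : Epi S.g.hom := NatTrans.epi_of_epi_app _
    exact Sheaf.Hom.epi_of_presheaf_epi J AddCommGrpCat.{w} S.g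
  refine ShortComplex.ShortExact.mk' (ShortComplex.exact_of_f_is_kernel _ ?_) inferInstance
    inferInstance
  refine KernelFork.IsLimit.ofι' S.f S.zero fun {W} k hk => ?_
  -- `g_U (k_U w) = 0` for every section `w`
  have hk' : ∀ (U) (w : W.obj.obj U), S.g.hom.app U (k.hom.app U w) = 0 := fun U w => by
    have h1 : (k ≫ S.g).hom.app U = 0 := by rw [hk]; rfl
    have h2 := ConcreteCategory.congr_hom h1 w
    simpa using h2
  -- the sectionwise lift through the injections `f_U`
  let L : ∀ U, W.obj.obj U → S.X₁.obj.obj U := fun U w => (hfg U _ (hk' U w)).choose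
  have key : ∀ (U) (w : W.obj.obj U), S.f.hom.app U (L U w) = k.hom.app U w := fun U w =>
    (hfg U _ (hk' U w)).choose_spec
  let Lh : ∀ U, W.obj.obj U →+ S.X₁.obj.obj U := fun U =>
    AddMonoidHom.mk' (L U) fun a b => hf U (by rw [map_add, key, key, key, map_add])
  have hLh : ∀ (U) (w : W.obj.obj U), Lh U w = L U w := fun U w => rfl
  refine ⟨ObjectProperty.homMk
    { app := fun U => AddCommGrpCat.ofHom (Lh U)
      naturality := fun U V i => ?_ }, ?_⟩
  · ext w
    apply hf V
    have n₁ := ConcreteCategory.congr_hom (S.f.hom.naturality i) (L U w)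
    have n₂ := ConcreteCategory.congr_hom (k.hom.naturality i) w
    simp only [ConcreteCategory.comp_apply] at n₁ n₂
    simp only [ConcreteCategory.comp_apply, AddCommGrpCat.hom_ofHom, hLh]
    rw [key V, n₁, key U, n₂]
  · apply ObjectProperty.hom_ext
    ext U w
    simp only [ObjectProperty.FullSubcategory.comp_hom, NatTrans.comp_app,
      ObjectProperty.homMk_hom, ConcreteCategory.comp_apply, AddCommGrpCat.hom_ofHom, hLh]
    exact key U w

end Sheaf

/-! ### Short exact sequences of coefficient groups -/

section Coefficients

variable {A B C : Type} [TopologicalSpace A] [AddCommGroup A] [IsTopologicalAddGroup A]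
  [TopologicalSpace B] [AddCommGroup B] [IsTopologicalAddGroup B]
  [TopologicalSpace C] [AddCommGroup C] [IsTopologicalAddGroup C]

/-- A **short exact sequence of topological abelian groups `0 → A →(φ) B →(ψ) C → 0` with `φ` an
embedding and `ψ` continuously split as a map of spaces**: `φ`, `ψ` continuous, `φ` injective
and inducing (a homeomorphism onto its image), `im φ = ker ψ`, and `ψ` admits a continuous
set-theoretic section. This is exactly what makes `0 → C(U, A) → C(U, B) → C(U, C) → 0` exact
for every topological space `U`. Examples: `0 → ℤ_ℓ →(ℓˢ) ℤ_ℓ → ℤ/ℓˢ → 0`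
(`isContinuousShortExact_powSMulHom`); any short exact sequence of discrete abelian groups.
[folklore] -/
structure IsContinuousShortExact (φ : A →+ B) (ψ : B →+ C) : Prop where
  /-- `φ` is continuous. -/
  continuous_left : Continuous φ
  /-- `ψ` is continuous. -/
  continuous_right : Continuous ψ
  /-- `φ` is injective. -/
  injective : Function.Injective φ
  /-- `φ` is a topological embedding (the topology of `A` is induced from `B`). -/
  isInducing : Topology.IsInducing φ
  /-- `ψ ∘ φ = 0`. -/
  comp_eq_zero : ψ.comp φ = 0
  /-- `ker ψ ⊆ im φ`. -/
  exact : ∀ b, ψ b = 0 → ∃ a, φ a = b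
  /-- `ψ` has a continuous set-theoretic section. -/
  exists_section : ∃ σ : C → B, Continuous σ ∧ ∀ c, ψ (σ c) = c

variable (X : Scheme.{u})

/-- The short complex `F_A → F_B → F_C` of `Ab.{u+1}`-valued sheaves on `X_proét` (`proetSheaf`,
`proetSheafMap` of `ProetCohomologyModule.lean`) attached to composable continuous homomorphisms
`φ`, `ψ` with `ψ ∘ φ = 0`. [folklore] -/
def proetSheafShortComplex (φ : A →+ B) (hφ : Continuous φ) (ψ : B →+ C) (hψ : Continuous ψ)
    (h0 : ψ.comp φ = 0) : ShortComplex (Sheaf (Scheme.ProEt.topology X) Ab.{u + 1}) :=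
  ShortComplex.mk (proetSheafMap X φ hφ) (proetSheafMap X ψ hψ) (by
    rw [← proetSheafMap_comp X φ hφ ψ hψ (hψ.comp hφ), proetSheafMap_congr h0 _
      ((continuous_const (y := (0 : C))).congr fun _ => rfl), proetSheafMap_zero])

/-- **`0 → F_A → F_B → F_C → 0` is a short exact sequence of sheaves on `X_proét`** whenever
`0 → A → B → C → 0` is a continuous short exact sequence (`IsContinuousShortExact`): on sections
over any `U`, `f ↦ φ ∘ f` is injective; a continuous `g : U → B` with `ψ ∘ g = 0` factors as
`φ ∘ g'` with `g'` continuous because `φ` is inducing; and `h : U → C` lifts to `σ ∘ h`. Then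
`shortExact_of_sections` applies. (Bhatt–Scholze Lemma 4.2.12: `T ↦ F_T`; for `C` discrete this
is the pro-étale avatar of the exactness of `0 → F_n → F_{n+s} → F_s → 0` in Milne V 1.11.)
[folklore] -/
theorem proetSheaf_shortExact {φ : A →+ B} {ψ : B →+ C} (h : IsContinuousShortExact φ ψ) :
    (proetSheafShortComplex X φ h.continuous_left ψ h.continuous_right
      h.comp_eq_zero).ShortExact := by
  refine shortExact_of_sections _ (fun U x y hxy => ?_) (fun U y hy => ?_) (fun U z => ?_) <;>
    dsimp only [proetSheafShortComplex] at *
  · -- injectivity on sections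
    change ULift.{u + 1} C(U.unop.left, A) at x y
    apply ULift.ext
    refine ContinuousMap.ext fun a => h.injective ?_
    exact congr_arg (fun f : ULift.{u + 1} C(U.unop.left, B) => f.down a) hxy
  · -- `ker ⊆ im` on sections
    change ULift.{u + 1} C(U.unop.left, B) at y
    have hy' : ∀ a, ψ (y.down a) = 0 := fun a =>
      congr_arg (fun f : ULift.{u + 1} C(U.unop.left, C) => f.down a) hy
    choose g hg using fun a => h.exact _ (hy' a)
    have hgc : Continuous g := by
      rw [h.isInducing.continuous_iff]
      convert y.down.continuous using 1
      exact funext hg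
    refine ⟨⟨⟨g, hgc⟩⟩, ?_⟩
    apply ULift.ext
    exact ContinuousMap.ext fun a => hg a
  · -- surjectivity on sections
    change ULift.{u + 1} C(U.unop.left, C) at z
    obtain ⟨σ, hσ, hσψ⟩ := h.exists_section
    refine ⟨⟨⟨σ ∘ z.down, hσ.comp z.down.continuous⟩⟩, ?_⟩
    apply ULift.ext
    exact ContinuousMap.ext fun a => hσψ (z.down a)

/-! ### The long exact cohomology sequence -/

variable {φ : A →+ B} {ψ : B →+ C}

/-- **The connecting homomorphism `δ : Hⁱ(X_proét, F_C) → Hʲ(X_proét, F_A)`, `j = i + 1`,** of a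
continuous short exact sequence `0 → A → B → C → 0`: composition with the extension class of
`0 → F_A → F_B → F_C → 0` (Mathlib `ShortExact.extClass`). [folklore] -/
def ProetCohomology.δ (h : IsContinuousShortExact φ ψ) (i j : ℕ) (hij : i + 1 = j) :
    ProetCohomology X C i →+ ProetCohomology X A j where
  toFun x := x.comp (proetSheaf_shortExact X h).extClass hij
  map_zero' := Abelian.Ext.zero_comp _ _ _ _ _
  map_add' x y := Abelian.Ext.add_comp x y _ _

/-- `Hⁱ(ψ) ∘ Hⁱ(φ) = 0`. [folklore] -/
theorem ProetCohomology.map_map_eq_zero (h : IsContinuousShortExact φ ψ) (i : ℕ)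
    (x : ProetCohomology X A i) :
    ProetCohomology.map X ψ h.continuous_right i
      (ProetCohomology.map X φ h.continuous_left i x) = 0 := by
  rw [← ProetCohomology.map_comp X φ h.continuous_left ψ h.continuous_right
      (h.continuous_right.comp h.continuous_left),
    ProetCohomology.map_congr h.comp_eq_zero _
      ((continuous_const (y := (0 : C))).congr fun _ => rfl),
    ProetCohomology.map_zero']

/-- `δ ∘ Hⁱ(ψ) = 0`. [folklore] -/
theorem ProetCohomology.δ_map_eq_zero (h : IsContinuousShortExact φ ψ) (i j : ℕ)
    (hij : i + 1 = j) (x : ProetCohomology X B i) :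
    ProetCohomology.δ X h i j hij (ProetCohomology.map X ψ h.continuous_right i x) = 0 := by
  change (x.comp (Abelian.Ext.mk₀ _) (add_zero i)).comp _ hij = 0
  rw [Abelian.Ext.comp_assoc_of_second_deg_zero]
  erw [(proetSheaf_shortExact X h).comp_extClass]
  exact Abelian.Ext.comp_zero x _ _ _ _

/-- `Hʲ(φ) ∘ δ = 0`. [folklore] -/
theorem ProetCohomology.map_δ_eq_zero (h : IsContinuousShortExact φ ψ) (i j : ℕ)
    (hij : i + 1 = j) (x : ProetCohomology X C i) :
    ProetCohomology.map X φ h.continuous_left j (ProetCohomology.δ X h i j hij x) = 0 := by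
  change (x.comp _ hij).comp (Abelian.Ext.mk₀ _) (add_zero j) = 0
  rw [Abelian.Ext.comp_assoc_of_third_deg_zero]
  erw [(proetSheaf_shortExact X h).extClass_comp]
  exact Abelian.Ext.comp_zero x _ _ _ _

/-- **Exactness at `Hʲ(X_proét, F_A)`**: a class killed by `Hʲ(φ)` is a boundary `δ x₃`
(`j = i + 1`). [folklore] -/
theorem ProetCohomology.exact₁ (h : IsContinuousShortExact φ ψ) {i j : ℕ} (hij : i + 1 = j)
    (x₁ : ProetCohomology X A j) (hx₁ : ProetCohomology.map X φ h.continuous_left j x₁ = 0) :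
    ∃ x₃ : ProetCohomology X C i, ProetCohomology.δ X h i j hij x₃ = x₁ :=
  Abelian.Ext.covariant_sequence_exact₁ _ (proetSheaf_shortExact X h) x₁ hx₁ hij

/-- **Exactness at `Hⁱ(X_proét, F_B)`**: a class killed by `Hⁱ(ψ)` comes from `Hⁱ(X_proét, F_A)`.
[folklore] -/
theorem ProetCohomology.exact₂ (h : IsContinuousShortExact φ ψ) {i : ℕ}
    (x₂ : ProetCohomology X B i) (hx₂ : ProetCohomology.map X ψ h.continuous_right i x₂ = 0) :
    ∃ x₁ : ProetCohomology X A i, ProetCohomology.map X φ h.continuous_left i x₁ = x₂ :=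
  Abelian.Ext.covariant_sequence_exact₂ _ (proetSheaf_shortExact X h) x₂ hx₂

/-- **Exactness at `Hⁱ(X_proét, F_C)`**: a class killed by `δ` comes from `Hⁱ(X_proét, F_B)`.
[folklore] -/
theorem ProetCohomology.exact₃ (h : IsContinuousShortExact φ ψ) {i j : ℕ} (hij : i + 1 = j)
    (x₃ : ProetCohomology X C i) (hx₃ : ProetCohomology.δ X h i j hij x₃ = 0) :
    ∃ x₂ : ProetCohomology X B i, ProetCohomology.map X ψ h.continuous_right i x₂ = x₃ :=
  Abelian.Ext.covariant_sequence_exact₃ _ (proetSheaf_shortExact X h) x₃ hij hx₃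

end Coefficients

/-! ### Milne's exact sequences `0 → Hʳ(Y, ℤ_ℓ)/ℓˢ → Hʳ(Y, ℤ/ℓˢ) → Hʳ⁺¹(Y, ℤ_ℓ)[ℓˢ] → 0` -/

section Bockstein

variable (Y : Scheme.{u}) (ℓ : ℕ) [Fact ℓ.Prime] (s : ℕ)

/-- **The Bockstein sequence `0 → ℤ_ℓ →(ℓˢ) ℤ_ℓ → ℤ/ℓˢ → 0` is a continuous short exact
sequence** (maps `powSMulHom`, `reductionHom` of part III: `a ↦ ℓˢ a` is a closed embedding of
the compact `ℤ_ℓ` with image `ℓˢℤ_ℓ = ker(ℤ_ℓ → ℤ/ℓˢ)`, Mathlib `PadicInt.ker_toZModPow`; `ℤ/ℓˢ` is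
discrete, so any set-theoretic section of the surjection `ℤ_ℓ → ℤ/ℓˢ` is continuous).
[folklore] -/
theorem isContinuousShortExact_powSMulHom :
    IsContinuousShortExact (powSMulHom ℓ s) (reductionHom ℓ s) where
  continuous_left := continuous_powSMulHom ℓ s
  continuous_right := continuous_reductionHom ℓ s
  injective := powSMulHom_injective
  isInducing := ((continuous_powSMulHom ℓ s).isClosedEmbedding powSMulHom_injective).isInducing
  comp_eq_zero := reductionHom_comp_powSMulHom ℓ s
  exact b hb := by
    have hb' : b ∈ RingHom.ker (PadicInt.toZModPow (p := ℓ) s) := hb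
    rw [PadicInt.ker_toZModPow, Ideal.mem_span_singleton'] at hb'
    obtain ⟨a, rfl⟩ := hb'
    exact ⟨a, by simp [smul_eq_mul, mul_comm]⟩
  exists_section := by
    obtain ⟨σ, hσ⟩ := (ZMod.ringHom_surjective (PadicInt.toZModPow (p := ℓ) s)).hasRightInverse
    exact ⟨σ, continuous_of_discreteTopology, hσ⟩

/-- **The Bockstein homomorphism `β : Hⁱ(Y_proét, ℤ/ℓˢ) → Hⁱ⁺¹(Y_proét, ℤ_ℓ)`**: the connecting map
of the cohomology sequence of `0 → ℤ_ℓ →(ℓˢ) ℤ_ℓ → ℤ/ℓˢ → 0` (the map `Hʳ(F_s) → Hʳ⁺¹(F)` of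
Milne V Lemma 1.11). [cite: Milne2025, V Lemma 1.11] -/
def ProetCohomology.bockstein (i : ℕ) :
    ProetCohomology Y (ZMod (ℓ ^ s)) i →+ ProetCohomology Y ℤ_[ℓ] (i + 1) :=
  ProetCohomology.δ Y (isContinuousShortExact_powSMulHom ℓ s) i (i + 1) rfl

/-- **Exactness of Milne's sequence at `Hⁱ(Y, ℤ/ℓˢ)`**: a class has Bockstein `0` iff it is the
reduction of a class in `Hⁱ(Y_proét, ℤ_ℓ)` — the surjection `Hʳ(F_s) → Hʳ⁺¹(F)_{lˢ} → 0` has kernel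
the image of `Hʳ(F) → Hʳ(F_s)` (V Lemma 1.11). [cite: Milne2025, V Lemma 1.11] -/
theorem ProetCohomology.bockstein_eq_zero_iff (i : ℕ) (z : ProetCohomology Y (ZMod (ℓ ^ s)) i) :
    ProetCohomology.bockstein Y ℓ s i z = 0 ↔ ∃ x : ProetCohomology Y ℤ_[ℓ] i,
      ProetCohomology.map Y (reductionHom ℓ s) (continuous_reductionHom ℓ s) i x = z :=
  ⟨fun hz => ProetCohomology.exact₃ Y (isContinuousShortExact_powSMulHom ℓ s) rfl z hz,
    fun ⟨x, hx⟩ => hx ▸ ProetCohomology.δ_map_eq_zero Y _ i (i + 1) rfl x⟩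

/-- **Exactness of Milne's sequence at `Hⁱ⁺¹(Y, ℤ_ℓ)`**: a class is killed by `ℓˢ` (canonical
`ℤ_ℓ`-action, `ProetCohomology.smul_def`) iff it is a Bockstein — the image of
`Hʳ(F_s) → Hʳ⁺¹(F)` is the `lˢ`-torsion `Hʳ⁺¹(F)_{lˢ}`, i.e. the kernel of `Hʳ⁺¹(F) →(lˢ) Hʳ⁺¹(F)`
(V Lemma 1.11). [cite: Milne2025, V Lemma 1.11] -/
theorem ProetCohomology.pow_smul_eq_zero_iff (i : ℕ) (w : ProetCohomology Y ℤ_[ℓ] (i + 1)) :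
    ((ℓ : ℤ_[ℓ]) ^ s) • w = 0 ↔
      ∃ z : ProetCohomology Y (ZMod (ℓ ^ s)) i, ProetCohomology.bockstein Y ℓ s i z = w := by
  rw [ProetCohomology.smul_def]
  exact ⟨fun hw => ProetCohomology.exact₁ Y (isContinuousShortExact_powSMulHom ℓ s) rfl w hw,
    fun ⟨z, hz⟩ => hz ▸ ProetCohomology.map_δ_eq_zero Y _ i (i + 1) rfl z⟩

/-- **Exactness of Milne's sequence at `Hⁱ(Y, ℤ_ℓ)`** (restated from part III for completeness of
the sequence): the kernel of the reduction `Hⁱ(Y_proét, ℤ_ℓ) → Hⁱ(Y_proét, ℤ/ℓˢ)` is `ℓˢ Hⁱ(Y_proét, ℤ_ℓ)`,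
so `Hʳ(F)^{(lˢ)} = Hʳ(F)/lˢ ↪ Hʳ(F_s)` (V Lemma 1.11). [cite: Milne2025, V Lemma 1.11] -/
theorem ProetCohomology.map_reductionHom_eq_zero_iff (i : ℕ) (x : ProetCohomology Y ℤ_[ℓ] i) :
    ProetCohomology.map Y (reductionHom ℓ s) (continuous_reductionHom ℓ s) i x = 0 ↔
      ∃ y : ProetCohomology Y ℤ_[ℓ] i, ((ℓ : ℤ_[ℓ]) ^ s) • y = x :=
  ⟨ProetCohomology.exists_pow_smul_eq_of_map_reductionHom_eq_zero Y ℓ s i x,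
    fun ⟨y, hy⟩ => hy ▸ ProetCohomology.map_reductionHom_pow_smul Y ℓ s i y⟩

end Bockstein

end Literature.AlgebraicGeometry.Motives

end
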